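import Mathlib
import Summits.Ventures.PercRepro2.HCov
import Summits.Ventures.PercRepro2.EdgeCubic
import Summits.Ventures.PercRepro2.ISplit
import Summits.Ventures.PercRepro2.CovFourTerm
import Summits.Ventures.PercRepro2.FirstOrderTerms
import Summits.Ventures.PercRepro2.FirstOrderPendantClass
import Summits.Ventures.PercRepro2.PendantCovMass
import Summits.Ventures.PercRepro2.PendantKRegime
import Summits.Ventures.PercRepro2.PendantB2Dict
import Summits.Ventures.PercRepro2.PendantDeficit
import Summits.Ventures.PercRepro2.PendantDmixThm

/-!
# Corollaries of `Dmix_nonneg` (blind cell PercRepro2, p5 g23; `proofs/P5-OEDGE.md` §29 add. 1)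

* `Kc_nonneg`: the pendant-root condition `(K)` holds on every instance (unconditionally);
* `Tcl_nonneg_of_HCov`: `T = D·Ψ(β,γ) + Q·D₀·Ψ(σ̄_b,γ₀) ≥ 0` on every non-degenerate instance
  satisfying `(HCOV)` — the row candidate 2′PROOT (`B2 ≥ 0`) on `0 < D₀·D`;
* `B2_nonneg_of_HCov_pendant`: `0 ≤ EdgeLine.B2` at a pendant root edge whose contraction
  satisfies `(HCOV)` (`0 < D₀·D`);
* `Tcl_eq_zero_of_D0_eq_zero` and `HCov_pendant_root_of_D0_eq_zero`: the degenerate case `D₀ = 0`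
  (then `D = 0` and `B2 = 0`), so the contraction needs no non-degeneracy when `D₀ = 0`.
-/

namespace Summit.Ventures.PercRepro2

open UnionCluster

namespace CovForm

namespace FirstOrder

section Main

variable {V : Type*} {E : Type*} [Fintype E] [DecidableEq E] [Fintype V] [DecidableEq V]
  {R : Type*} [Field R] [LinearOrder R] [IsStrictOrderedRing R]

/-- **The pendant-root condition `(K)` holds on every instance**: `0 ≤ Kc`. -/
theorem Kc_nonneg (p : E → R) (hp : IsProbVec p) (ends : E → Sym2 V) (o a₁ a₂ a₃ b : V) :
    0 ≤ Kc p ends o a₁ a₂ a₃ b :=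
  Kc_nonneg_of_Dmix p hp ends o a₁ a₂ a₃ b (Dmix_nonneg p hp ends o a₁ a₂ a₃ b)

/-- **`T ≥ 0` on every non-degenerate instance satisfying `(HCOV)`** (2′PROOT on `0 < D₀·D`). -/
theorem Tcl_nonneg_of_HCov (p : E → R) (hp : IsProbVec p) (ends : E → Sym2 V) (o a₁ a₂ a₃ b : V)
    (h : HCov p ends o a₁ a₂ a₃ b)
    (hpos : 0 < D0 p ends a₁ a₃ * prob p (PDEvent ends a₁ a₂ a₃)) :
    0 ≤ Tcl p ends o a₁ a₂ a₃ b := by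
  have hK := Kc_nonneg p hp ends o a₁ a₂ a₃ b
  have hG : 0 ≤ Gc p ends o a₁ a₂ a₃ b := h
  have hid := two_D0_D_Tcl p ends o a₁ a₂ a₃ b
  have h0 : 0 ≤ D0 p ends a₁ a₃ ^ 2 := sq_nonneg _
  have hprod : 0 ≤ 2 * D0 p ends a₁ a₃ * prob p (PDEvent ends a₁ a₂ a₃) * Tcl p ends o a₁ a₂ a₃ b := by
    rw [hid]; nlinarith [mul_nonneg h0 hG]
  have h2pos : 0 < 2 * D0 p ends a₁ a₃ * prob p (PDEvent ends a₁ a₂ a₃) := by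
    rw [mul_assoc]; exact mul_pos two_pos hpos
  exact nonneg_of_mul_nonneg_right hprod h2pos

omit [Fintype V] in
/-- `D ≤ D₀` (`PD ⊆ {a₃ ∉ C₁}`). -/
lemma PD_le_D0 (p : E → R) (hp : IsProbVec p) (ends : E → Sym2 V) (a₁ a₂ a₃ : V) :
    prob p (PDEvent ends a₁ a₂ a₃) ≤ D0 p ends a₁ a₃ := by
  unfold D0
  refine prob_mono hp fun ω hω => ?_
  rw [ISplit.PD_eq_R_inter] at hω
  intro y hy hc
  rw [Finset.mem_singleton] at hy
  rw [hy] at hc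
  exact hω.1 a₃ (Finset.mem_insert_of_mem (Finset.mem_singleton_self a₃)) hc

omit [Fintype V] in
/-- **The degenerate case `D₀ = 0`**: every term of `Tcl` vanishes. -/
theorem Tcl_eq_zero_of_D0_eq_zero (p : E → R) (hp : IsProbVec p) (ends : E → Sym2 V)
    (o a₁ a₂ a₃ b : V) (h0 : D0 p ends a₁ a₃ = 0) : Tcl p ends o a₁ a₂ a₃ b = 0 := by
  have hD : prob p (PDEvent ends a₁ a₂ a₃) = 0 :=
    le_antisymm (h0 ▸ PD_le_D0 p hp ends a₁ a₂ a₃) (prob_nonneg hp _)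
  have hDo : Do p ends o a₁ a₂ a₃ = 0 := by
    unfold Do
    have h1 : prob p (PDEvent ends a₁ a₂ a₃ ∩ connEvent ends a₁ o) = 0 :=
      le_antisymm (hD ▸ prob_inter_le_left hp _ _) (prob_nonneg hp _)
    have h2 : prob p (PDEvent ends a₁ a₂ a₃ ∩ connEvent ends a₂ o) = 0 :=
      le_antisymm (hD ▸ prob_inter_le_left hp _ _) (prob_nonneg hp _)
    rw [h1, h2]; ring
  have hDo0 : Do0 p ends o a₁ a₃ = 0 := by
    unfold Do0
    unfold D0 at h0
    exact le_antisymm (h0 ▸ prob_inter_le_left hp _ _) (prob_nonneg hp _)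
  unfold Tcl Cfo FourTerm.Cc Dmix
  rw [hD, hDo, hDo0, h0]
  ring

/-- **The degree-one-root contraction in the degenerate case `D₀ = 0`**: `B2 = 0`, so `(HCOV)` at
the contraction gives `(HCOV)` at the pendant instance without any non-degeneracy. -/
theorem HCov_pendant_root_of_D0_eq_zero {ends : E → Sym2 V} {p : E → R} {e : E} {a₂ z : V}
    (hp : IsProbVec p) (he : p e ≠ 1) (hleaf : ∀ f, a₂ ∈ ends f → f = e)
    (hends : ends e = s(a₂, z)) {o a₁ a₃ b : V} (ho : o ≠ a₂) (h1 : a₁ ≠ a₂) (h3 : a₃ ≠ a₂)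
    (hb : b ≠ a₂) (h₁ : HCov (Function.update p e 1) ends o a₁ a₂ a₃ b)
    (h0 : D0 (Function.update p e 1) ends a₁ a₃ = 0) : HCov p ends o a₁ a₂ a₃ b := by
  apply HCov_pendant_root_of_B2 hp he hleaf hends ho h1 h3 hb h₁
  rw [B2_eq_two_Tcl he hleaf hends ho h1 h3 hb,
    Tcl_eq_zero_of_D0_eq_zero (Function.update p e 1) (hp.update e zero_le_one le_rfl) ends o a₁ a₂ a₃ b h0]
  norm_num

/-- **`B2 ≥ 0` at a pendant root edge whose contraction satisfies `(HCOV)`** (`0 < D₀·D`). -/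
theorem B2_nonneg_of_HCov_pendant {ends : E → Sym2 V} {p : E → R} {e : E} {a₂ z : V}
    (hp : IsProbVec p) (he : p e ≠ 1) (hleaf : ∀ f, a₂ ∈ ends f → f = e)
    (hends : ends e = s(a₂, z)) {o a₁ a₃ b : V} (ho : o ≠ a₂) (h1 : a₁ ≠ a₂) (h3 : a₃ ≠ a₂)
    (hb : b ≠ a₂) (h₁ : HCov (Function.update p e 1) ends o a₁ a₂ a₃ b)
    (hpos : 0 < D0 (Function.update p e 1) ends a₁ a₃ *
      prob (Function.update p e 1) (PDEvent ends a₁ a₂ a₃)) :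
    0 ≤ EdgeLine.B2 p ends o a₁ a₂ a₃ b e := by
  rw [B2_eq_two_Tcl he hleaf hends ho h1 h3 hb]
  have := Tcl_nonneg_of_HCov (Function.update p e 1) (hp.update e zero_le_one le_rfl) ends o a₁ a₂ a₃ b
    h₁ hpos
  linarith

end Main

end FirstOrder

end CovForm

end Summit.Ventures.PercRepro2
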